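import Literature.Algebra.Homology.OrderedCechSystemAugmentExact
import Literature.Algebra.Homology.OrderedCechPairSystemFlip
import HarnessLib

/-!
# The column criterion of the ordered Čech bicomplex from the individual systems `P(σ, ·)` (Stacks 0BEC, 0133)

Layer `Literature/Algebra/Homology` (proved lemmas only; 0 `def`, 0 named facts, no instance, no notation; pure homological algebra over
a commutative ring `A`). The comparison theorems of `Algebra/Homology/OrderedCechPairSystemResolution(Memberwise)` ask, column by column,
that the `κ`-system of `σ`-cochains `cochainSystem P a = (t ↦ Čᵃ(P(·, t)) = Π_σ P σ t)` be Čech-resolved by its empty member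
`Čᵃ(P(·, ∅))` (hypothesis (H2col): `QuasiIso (sysAugmentHom (cochainSystem P a))`). Since that system is the PRODUCT over the
`a`-simplices `σ` of the `κ`-systems `P(σ, ·) = P.obj σ`, and the augmentation and the Čech differentials act componentwise in `σ`
(`sysAugment_cochainSystem_apply`, `sysD_cochainSystem_apply`, `sysComplex_d_cochainSystem_apply` — slicing at `σ`, via
`Algebra/Homology/OrderedCechPairSystemFlip.ext0At_cochainSystem_apply`), the elementwise resolution conditions for EACH `P(σ, ·)`
give those for `cochainSystem P a` by componentwise choice, whence

* **`quasiIso_sysAugmentHom_cochainSystem_of_memberwise`** — (H2col) in column `a` from: for every `a`-simplex `σ`, the augmented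
  ordered Čech complex `P σ ∅ → Č⁰(P(σ, ·)) → Č¹(P(σ, ·)) → ⋯` is exact (elementwise binders, as in
  `Algebra/Homology/OrderedCechSystemAugmentExact.quasiIso_sysAugmentHom_of_exact`).

Library only (cell `pub-hodge-ring2`, count-neutral); proves nothing about any crux, route or conjecture. Mathlib searched (pin v4.32):
`HomologicalComplex.shape`, `Finset.sum_apply`, `Pi.smul_apply` (used).

## References

* The Stacks Project, Tag 0BEC (Künneth: the double Čech complex), Tag 0133, Tag 01FG. [StacksProject]
* U. Görtz, T. Wedhorn, *Algebraic Geometry II* (2023), Def. 21.68 (p. 180). [GortzWedhorn2023]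
-/

universe u

open CategoryTheory CategoryTheory.Limits HomologicalComplex

set_option backward.isDefEq.respectTransparency false

namespace Literature.Algebra.Homology

namespace OrderedCech

variable {A : Type u} [CommRing A] {ι κ : Type} [LinearOrder ι] [LinearOrder κ]
  (P : Finset ι ⥤ Finset κ ⥤ ModuleCat.{u} A)

/-! ### §1 Slicing at an `a`-simplex `σ` -/

/-- The augmentation of `cochainSystem P a` is, componentwise in `σ`, the augmentation of `P(σ, ·)` (`rfl`).
[cite: GortzWedhorn2023, Def. 21.68 (p. 180)] -/
theorem sysAugment_cochainSystem_apply (a : ℤ) (g : SysCochain (P.flip.obj ∅) a) (τ : Simplex κ 0) (σ : Simplex ι a) :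
    (sysAugment (cochainSystem P a) g τ : SysCochain (P.flip.obj τ.1) a) σ = sysAugment (P.obj σ.1) (g σ) τ := rfl

/-- The Čech differential of `cochainSystem P a` is, componentwise in `σ`, the Čech differential of `P(σ, ·)`.
[cite: GortzWedhorn2023, Def. 21.68 (p. 180)] -/
theorem sysD_cochainSystem_apply (a b : ℤ) (x : SysCochain (cochainSystem P a) b) (τ' : Simplex κ (b + 1)) (σ : Simplex ι a) :
    (sysD (cochainSystem P a) b x τ' : SysCochain (P.flip.obj τ'.1) a) σ =
      sysD (P.obj σ.1) b (fun τ => (x τ : SysCochain (P.flip.obj τ.1) a) σ) τ' := by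
  rw [sysD_apply, sysD_apply, Finset.sum_apply]
  refine Finset.sum_congr rfl fun j _ => ?_
  rw [Pi.smul_apply, ext0At_cochainSystem_apply]

/-- The differentials of `Č•(cochainSystem P a)`, componentwise in `σ`, are those of `Č•(P(σ, ·))` (any pair of degrees).
[cite: GortzWedhorn2023, Def. 21.68 (p. 180)] -/
theorem sysComplex_d_cochainSystem_apply (a i j : ℤ) (y : SysCochain (cochainSystem P a) i) (τ : Simplex κ j)
    (σ : Simplex ι a) :
    ((((sysComplex (cochainSystem P a)).d i j).hom y : SysCochain (cochainSystem P a) j) τ :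
        SysCochain (P.flip.obj τ.1) a) σ =
      (((sysComplex (P.obj σ.1)).d i j).hom (fun τ => (y τ : SysCochain (P.flip.obj τ.1) a) σ) :
        SysCochain (P.obj σ.1) j) τ := by
  by_cases hij : i + 1 = j
  · subst hij
    rw [sysComplex_d, sysComplex_d]
    exact sysD_cochainSystem_apply P a i y τ σ
  · rw [(sysComplex (cochainSystem P a)).shape i j hij, (sysComplex (P.obj σ.1)).shape i j hij]
    rfl

/-! ### §2 The column criterion from the systems `P(σ, ·)` -/

/-- **(H2col) in column `a` from the individual systems**: if for every `a`-simplex `σ` the augmented ordered Čech complex of the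
`κ`-system `P(σ, ·)` is exact — `ε_σ` injective, every `0`-cocycle an augmented value, exactness in degrees `≥ 1` (elementwise) — then
the augmentation `Čᵃ(P(·, ∅))[0] ⟶ Č•(cochainSystem P a)` is a quasi-isomorphism (componentwise choice over the finite product
`Π_σ`, then `quasiIso_sysAugmentHom_of_exact`). [cite: StacksProject, Tag 0133] [cite: StacksProject, Tag 0BEC] -/
theorem quasiIso_sysAugmentHom_cochainSystem_of_memberwise (a : ℤ)
    (hinj : ∀ σ : Simplex ι a, Function.Injective (sysAugment (P.obj σ.1)))
    (hex₀ : ∀ σ : Simplex ι a, ∀ x : SysCochain (P.obj σ.1) 0, sysD (P.obj σ.1) 0 x = 0 →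
      ∃ g : (P.obj σ.1).obj ∅, sysAugment (P.obj σ.1) g = x)
    (hex : ∀ σ : Simplex ι a, ∀ n : ℤ, 1 ≤ n → ∀ x : SysCochain (P.obj σ.1) n,
      ((sysComplex (P.obj σ.1)).d n (n + 1)).hom x = 0 →
        ∃ y : SysCochain (P.obj σ.1) (n - 1), ((sysComplex (P.obj σ.1)).d (n - 1) n).hom y = x) :
    QuasiIso (sysAugmentHom (cochainSystem P a)) := by
  apply quasiIso_sysAugmentHom_of_exact
  · -- injectivity, componentwise in `σ`
    intro g g' h
    funext σ
    apply hinj σ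
    funext τ
    exact congr_fun (congr_fun h τ) σ
  · -- `0`-cocycles, componentwise in `σ`
    intro x hx
    have hc : ∀ σ : Simplex ι a, ∃ g : (P.obj σ.1).obj ∅,
        sysAugment (P.obj σ.1) g = fun τ => (x τ : SysCochain (P.flip.obj τ.1) a) σ := fun σ =>
      hex₀ σ _ (funext fun τ' => by
        have := congr_fun (congr_fun hx τ') σ
        rw [sysD_cochainSystem_apply] at this
        exact this)
    choose g hg using hc
    exact ⟨fun σ => g σ, funext fun τ => funext fun σ => congr_fun (hg σ) τ⟩
  · -- exactness in degrees `≥ 1`, componentwise in `σ`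
    intro n hn x hx
    have hc : ∀ σ : Simplex ι a, ∃ y : SysCochain (P.obj σ.1) (n - 1),
        ((sysComplex (P.obj σ.1)).d (n - 1) n).hom y = fun τ => (x τ : SysCochain (P.flip.obj τ.1) a) σ := fun σ =>
      hex σ n hn _ (funext fun τ' => by
        have := congr_fun (congr_fun hx τ') σ
        rw [sysComplex_d_cochainSystem_apply] at this
        exact this)
    choose y hy using hc
    refine ⟨fun τ σ => y σ τ, funext fun τ => funext fun σ => ?_⟩
    rw [sysComplex_d_cochainSystem_apply]
    exact congr_fun (hy σ) τ

end OrderedCech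

end Literature.Algebra.Homology
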